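import Summits.QuantumFields.YangMills.Theorems.SwapVirialDeficitSwapRingDeficitMoments
import HarnessLib

/-!
# The followers' cubic virial remainder is `o(1)` on a Laplace window — ε-form of the window-uniform `3/2`-moment bound

Companion of ✓`…SwapRingDeficitMoments` (its header announces this ε-form; the 400-line cap put it here).  From ✓`swap_deficit_threeHalves_moment_le`
(`b·∫F₀^{3/2}e^{−bF₀} dμ_L ≤ C·(L⁴(1 + log L + log b))^{3/2}·b^{−1/2}·Z₀(b)`, every `L`, `b ≥ β₁`) and the window arithmetic `a = 1/(4(q + 8))`:

* `window_pow_mul_rpow_le` — for `0 < a ≤ 1`, `b ≥ e`, `1 ≤ L ≤ b^a`, `q : ℕ`: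
  `L^q·(L⁴(1 + log L + log b))^{3/2}·b^{−1/2} ≤ (3/a)^{3/2}·b^{a(q + 15/2) − 1/2}` (`log b ≤ b^a/a`, Mathlib `Real.log_le_rpow_div`);
* ★★ `swap_deficit_threeHalves_window` — `∀ q : ℕ, ∀ ε > 0, ∃ a > 0, β₂ ≥ 1: b ≥ β₂, L ≤ b^a ⟹ b·L^q·∫F₀^{3/2}e^{−bF₀} dμ_L ≤ ε·∫e^{−bF₀} dμ_L`
  (`F₀ = swapRingDeficit L 0`, `μ_L = ringMeasure L`): the shape in which a pointwise Taylor bound `|R_F| ≤ C·L^q·F̂^{3/2}` on the followers' part of the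
  virial remainder `β·K_L⟪R⟫₀` (✓`virial_ring`; w2 g57 memo2 remark 4, fcl-p3 g46 memo2 §3) enters the window row of ⟨stmt-QuantumFields-24197⟩.

HONEST LABEL: window arithmetic on a crude, window-uniform concentration bound for the DRAFT virial line; (LW) ∕ (M) ∕ ⟨24197⟩ (window-uniform) ∕ ⟨24194⟩ ∕
⟨24196⟩ ∕ ⟨24497⟩ OPEN; own crux ⟨22884⟩ OPEN (blocked-on ⟨19935⟩); no crux, rung of record or summit is proved; the Yang–Mills mass gap is NOT proved; no
summit is proved by a line.  THEOREMS ONLY (0 `def`, 0 `sorry`), standard axioms.  Width seat ym-line-sfw-p2-w3 g65 (cell ym-idea-1, free hands),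
`--supports stmt-QuantumFields-24197`.  References: [cite: Griffiths1964]; [cite: Luscher1983, §2]; [folklore].
-/

set_option autoImplicit false

noncomputable section

open MeasureTheory Set Filter
open scoped BigOperators Topology
open Literature.MathematicalPhysics.QuantumFieldTheory hiding SU2
open Literature.MathematicalPhysics.QuantumLattice

namespace Summit.QuantumFields.YangMills.Theorems.SwapVirialDeficit.SwapRing

open Summit.QuantumFields.YangMills.Theorems.FemtoTransferGap
open Summit.QuantumFields.YangMills.Theorems.VirialFluxGap.RingDeficit

/-- Window arithmetic: for `0 < a ≤ 1`, `b ≥ e`, `1 ≤ L ≤ b^a` and `q : ℕ`,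
`L^q · (L⁴·(1 + log L + log b))^{3/2} · b^{−1/2} ≤ (3/a)^{3/2} · b^{a·(q + 15/2) − 1/2}`. [folklore] -/
theorem window_pow_mul_rpow_le {a b : ℝ} (ha : 0 < a) (ha1 : a ≤ 1) (hb : Real.exp 1 ≤ b) {L : ℕ} (hL1 : 1 ≤ L) (hLb : (L : ℝ) ≤ b ^ a)
    (q : ℕ) :
    (L : ℝ) ^ q * ((L : ℝ) ^ 4 * (1 + Real.log L + Real.log b)) ^ ((3 : ℝ) / 2) * b ^ (-(1 : ℝ) / 2) ≤
      (3 / a) ^ ((3 : ℝ) / 2) * b ^ (a * (q + 15 / 2) - 1 / 2) := by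
  have hb0 : 0 < b := (Real.exp_pos 1).trans_le hb
  have hb1 : 1 ≤ b := le_trans (by have := Real.add_one_le_exp (1 : ℝ); linarith) hb
  have hlogb1 : 1 ≤ Real.log b := by rw [← Real.log_exp 1]; exact Real.log_le_log (Real.exp_pos 1) hb
  have hL : (1 : ℝ) ≤ L := by exact_mod_cast hL1
  have hL0 : (0 : ℝ) ≤ L := by positivity
  have hba : 0 < b ^ a := Real.rpow_pos_of_pos hb0 a
  -- `log L ≤ a log b ≤ log b`, so `ℓ ≤ 3 log b ≤ (3/a) b^a`
  have hlogL : Real.log L ≤ Real.log b := by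
    calc Real.log L ≤ Real.log (b ^ a) := Real.log_le_log (by positivity) hLb
      _ = a * Real.log b := Real.log_rpow hb0 a
      _ ≤ 1 * Real.log b := mul_le_mul_of_nonneg_right ha1 (by linarith)
      _ = Real.log b := one_mul _
  have hℓ : 1 + Real.log L + Real.log b ≤ 3 / a * b ^ a := by
    have h1 : Real.log b ≤ b ^ a / a := Real.log_le_rpow_div hb0.le ha
    have h2 : 1 + Real.log L + Real.log b ≤ 3 * Real.log b := by linarith
    calc 1 + Real.log L + Real.log b ≤ 3 * Real.log b := h2
      _ ≤ 3 * (b ^ a / a) := by linarith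
      _ = 3 / a * b ^ a := by ring
  have hℓ0 : 0 ≤ 1 + Real.log L + Real.log b := by have := Real.log_nonneg hL; linarith
  -- `L⁴ ≤ b^{4a}`, `L^q ≤ b^{aq}`
  have hpow : ∀ n : ℕ, (L : ℝ) ^ n ≤ b ^ (a * n) := fun n => by
    calc (L : ℝ) ^ n ≤ (b ^ a) ^ n := pow_le_pow_left₀ hL0 hLb n
      _ = b ^ (a * n) := by rw [← Real.rpow_natCast, ← Real.rpow_mul hb0.le]
  have hX : (L : ℝ) ^ 4 * (1 + Real.log L + Real.log b) ≤ 3 / a * b ^ (5 * a) := by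
    calc (L : ℝ) ^ 4 * (1 + Real.log L + Real.log b) ≤ b ^ (a * (4 : ℕ)) * (3 / a * b ^ a) :=
          mul_le_mul (hpow 4) hℓ hℓ0 (Real.rpow_nonneg hb0.le _)
      _ = 3 / a * (b ^ (a * (4 : ℕ)) * b ^ a) := by ring
      _ = 3 / a * b ^ (5 * a) := by rw [← Real.rpow_add hb0]; congr 2; push_cast; ring
  have hX32 : ((L : ℝ) ^ 4 * (1 + Real.log L + Real.log b)) ^ ((3 : ℝ) / 2) ≤ (3 / a) ^ ((3 : ℝ) / 2) * b ^ (15 / 2 * a) := by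
    calc ((L : ℝ) ^ 4 * (1 + Real.log L + Real.log b)) ^ ((3 : ℝ) / 2) ≤ (3 / a * b ^ (5 * a)) ^ ((3 : ℝ) / 2) :=
          Real.rpow_le_rpow (by positivity) hX (by norm_num)
      _ = (3 / a) ^ ((3 : ℝ) / 2) * b ^ (15 / 2 * a) := by
          rw [Real.mul_rpow (by positivity) (Real.rpow_nonneg hb0.le _), ← Real.rpow_mul hb0.le]
          congr 2; ring
  -- assemble the powers of `b`
  have e : b ^ (a * (q : ℕ)) * b ^ (15 / 2 * a) * b ^ (-(1 : ℝ) / 2) = b ^ (a * (q + 15 / 2) - 1 / 2) := by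
    rw [← Real.rpow_add hb0, ← Real.rpow_add hb0]; congr 1; ring
  calc (L : ℝ) ^ q * ((L : ℝ) ^ 4 * (1 + Real.log L + Real.log b)) ^ ((3 : ℝ) / 2) * b ^ (-(1 : ℝ) / 2)
      ≤ b ^ (a * (q : ℕ)) * ((3 / a) ^ ((3 : ℝ) / 2) * b ^ (15 / 2 * a)) * b ^ (-(1 : ℝ) / 2) :=
        mul_le_mul_of_nonneg_right (mul_le_mul (hpow q) hX32 (Real.rpow_nonneg (by positivity) _) (Real.rpow_nonneg hb0.le _))
          (Real.rpow_nonneg hb0.le _)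
    _ = (3 / a) ^ ((3 : ℝ) / 2) * (b ^ (a * (q : ℕ)) * b ^ (15 / 2 * a) * b ^ (-(1 : ℝ) / 2)) := by ring
    _ = (3 / a) ^ ((3 : ℝ) / 2) * b ^ (a * (q + 15 / 2) - 1 / 2) := by rw [e]

/-- ★★ **THE FOLLOWERS' CUBIC REMAINDER IS `o(1)` ON A WINDOW, ε-form**: for every polynomial weight `L^q` (`q : ℕ`) and every `ε > 0` there are `a > 0`
and `β₂ ≥ 1` such that for `b ≥ β₂` and every `L ≥ 1` with `L ≤ b^a`,
`b · L^q · ∫ F₀^{3/2} e^{−bF₀} dμ_L ≤ ε · ∫ e^{−bF₀} dμ_L`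
(✓`swap_deficit_threeHalves_moment_le` and the window arithmetic `a = 1/(4(q + 8))`). This is the shape in which a pointwise Taylor bound
`|R_F| ≤ C·L^q·F̂^{3/2}` on the followers' part of the virial remainder enters the window row of ⟨24197⟩. [cite: Griffiths1964] [cite: Luscher1983, §2] -/
theorem swap_deficit_threeHalves_window (q : ℕ) {ε : ℝ} (hε : 0 < ε) :
    ∃ a : ℝ, 0 < a ∧ ∃ β₂ : ℝ, 1 ≤ β₂ ∧ ∀ (b : ℝ), β₂ ≤ b → ∀ (L : ℕ) [NeZero L], (L : ℝ) ≤ b ^ a →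
      b * (L : ℝ) ^ q * ∫ p, swapRingDeficit L (fun _ => false) p ^ ((3 : ℝ) / 2) * Real.exp (-b * swapRingDeficit L (fun _ => false) p) ∂(ringMeasure L) ≤
        ε * ∫ p, Real.exp (-b * swapRingDeficit L (fun _ => false) p) ∂(ringMeasure L) := by
  obtain ⟨C, hC, β₁, hβ₁, h⟩ := swap_deficit_threeHalves_moment_le
  set a : ℝ := 1 / (4 * ((q : ℝ) + 8)) with hadef
  have hq0 : (0 : ℝ) ≤ q := Nat.cast_nonneg q
  have ha : 0 < a := by rw [hadef]; positivity
  have ha1 : a ≤ 1 := by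
    rw [hadef, div_le_one (by positivity)]; nlinarith
  set K : ℝ := C * (3 / a) ^ ((3 : ℝ) / 2) with hKdef
  have hK : 0 < K := by rw [hKdef]; positivity
  refine ⟨a, ha, max (max β₁ (Real.exp 1)) ((K / ε) ^ 4), le_trans hβ₁ ((le_max_left _ _).trans (le_max_left _ _)), fun b hb L _ hLb => ?_⟩
  have hbβ₁ : β₁ ≤ b := ((le_max_left _ _).trans (le_max_left _ _)).trans hb
  have hbe : Real.exp 1 ≤ b := ((le_max_right _ _).trans (le_max_left _ _)).trans hb
  have hbK : (K / ε) ^ 4 ≤ b := (le_max_right _ _).trans hb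
  have hb0 : 0 < b := (Real.exp_pos 1).trans_le hbe
  have hb1 : 1 ≤ b := hβ₁.trans hbβ₁
  have hL1 : 1 ≤ L := NeZero.one_le
  set Z : ℝ := ∫ p, Real.exp (-b * swapRingDeficit L (fun _ => false) p) ∂(ringMeasure L) with hZ
  have hZ0 : 0 ≤ Z := integral_nonneg fun p => (Real.exp_pos _).le
  have hmain := h L b hbβ₁
  have hwin := window_pow_mul_rpow_le ha ha1 hbe hL1 hLb q
  -- the exponent `a(q + 15/2) − 1/2 ≤ −1/4`
  have hexp : a * (q + 15 / 2) - 1 / 2 ≤ -(1 / 4 : ℝ) := by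
    have : a * ((q : ℝ) + 15 / 2) ≤ 1 / 4 := by
      rw [hadef, div_mul_eq_mul_div, one_mul, div_le_iff₀ (by positivity)]; nlinarith
    linarith
  have hb14 : b ^ (a * (q + 15 / 2) - 1 / 2) ≤ b ^ (-(1 / 4 : ℝ)) := Real.rpow_le_rpow_of_exponent_le hb1 hexp
  -- `b^{−1/4} ≤ ε / K` from `b ≥ (K/ε)^4`
  have hKε : 0 < K / ε := div_pos hK hε
  have hb4 : K / ε ≤ b ^ ((1 : ℝ) / 4) := by
    have h1 : ((K / ε) ^ 4) ^ ((1 : ℝ) / 4) ≤ b ^ ((1 : ℝ) / 4) := Real.rpow_le_rpow (by positivity) hbK (by norm_num)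
    have h2 : ((K / ε) ^ 4) ^ ((1 : ℝ) / 4) = K / ε := by
      rw [← Real.rpow_natCast, ← Real.rpow_mul hKε.le]; norm_num
    rwa [h2] at h1
  have hbinv : b ^ (-(1 / 4 : ℝ)) ≤ ε / K := by
    rw [show (-(1 / 4 : ℝ)) = -((1 : ℝ) / 4) by norm_num, Real.rpow_neg hb0.le]
    rw [inv_le_comm₀ (Real.rpow_pos_of_pos hb0 _) (div_pos hε hK), inv_div]
    exact hb4
  have hLq : (0 : ℝ) ≤ (L : ℝ) ^ q := by positivity
  calc b * (L : ℝ) ^ q * ∫ p, swapRingDeficit L (fun _ => false) p ^ ((3 : ℝ) / 2) *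
          Real.exp (-b * swapRingDeficit L (fun _ => false) p) ∂(ringMeasure L)
      = (L : ℝ) ^ q * (b * ∫ p, swapRingDeficit L (fun _ => false) p ^ ((3 : ℝ) / 2) *
          Real.exp (-b * swapRingDeficit L (fun _ => false) p) ∂(ringMeasure L)) := by ring
    _ ≤ (L : ℝ) ^ q * (C * ((L : ℝ) ^ 4 * (1 + Real.log L + Real.log b)) ^ ((3 : ℝ) / 2) * b ^ (-(1 : ℝ) / 2) * Z) :=
        mul_le_mul_of_nonneg_left hmain hLq
    _ = C * ((L : ℝ) ^ q * ((L : ℝ) ^ 4 * (1 + Real.log L + Real.log b)) ^ ((3 : ℝ) / 2) * b ^ (-(1 : ℝ) / 2)) * Z := by ring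
    _ ≤ C * ((3 / a) ^ ((3 : ℝ) / 2) * b ^ (a * (q + 15 / 2) - 1 / 2)) * Z :=
        mul_le_mul_of_nonneg_right (mul_le_mul_of_nonneg_left hwin hC.le) hZ0
    _ = K * b ^ (a * (q + 15 / 2) - 1 / 2) * Z := by rw [hKdef]; ring
    _ ≤ K * (ε / K) * Z := mul_le_mul_of_nonneg_right (mul_le_mul_of_nonneg_left (hb14.trans hbinv) hK.le) hZ0
    _ = ε * Z := by field_simp

end Summit.QuantumFields.YangMills.Theorems.SwapVirialDeficit.SwapRing

end
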